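import Literature.MathematicalPhysics.QuantumFieldTheory.BalabanImbrieJaffe1984to88.BIJ88NeumannPropagator227Torus
import Literature.MathematicalPhysics.QuantumFieldTheory.BalabanImbrieJaffe1984to88.BIJ85BlockKPoincare
import Literature.MathematicalPhysics.QuantumFieldTheory.Balaban1983to89.B5Ineq137Torus

/-!
# `BalabanImbrieJaffe1984to88.BIJ88NeumannPropagatorTranslCovTorus` — the block lattice acts on the torus of record: `x_k`, `B^k(y)`, `u^{(k)}`, `u(Γ^{(k)}_{x_k,x})`, `H_{k,Ω}(u)`, `G_k(Ω,u)` under `x ↦ x + v`, `v ∈ L^kℤ^d`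

T. Bałaban, J. Imbrie, A. Jaffe, *Renormalization of the Higgs model: minimizers, propagators and the stability of mean field theory*,
Comm. Math. Phys. **97** (1985) 299–329 [BalabanImbrieJaffe1985], (2.4)–(2.5) p. 302 (blocks `B(y)`, corners `y = Ln`, the standard
contours `Γ_{yx}` and transports `u(Γ_{yx})`), (5.1.2)–(5.1.3) p. 313 (the iterated blocks `B^k(y)` and composite contours); T. Bałaban,
J. Imbrie, A. Jaffe, *Effective action and cluster properties of the abelian Higgs model*, Comm. Math. Phys. **114** (1988) 257–315
[BalabanImbrieJaffe1988], (1.1) p. 258 (periodic boundary conditions: the model lives on a TORUS), (2.27) p. 263 (the Neumann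
propagators `G_k(Ω, u)`).

## What this file proves (pure bookkeeping — EVERY `U(1)` field, every region, every level of the standing range)

The torus `T^{(j)}` of record is homogeneous, but the block constructions of [BalabanImbrieJaffe1985] §2/§5 (block map = integer
division of the labels by `L`, corners, corner-anchored contours) are equivariant only under the translations by vectors of the
`k`-BLOCK LATTICE `L^kℤ^d` (`IsCoarse k v`: every label of `v` divisible by `L^k`).  For such `v` and the translated field
`(τ_vU)(b) = U(b + v)` (`GaugeField.translate`, `Balaban1983to89.TorusLimitAxioms`):

* §2–§3 (the [BalabanImbrieJaffe1985] objects of `BIJ85BlockAveragesTorus`/`BIJ85BlockAveragesTorusK`): `inBlock_add`, `blockOf_add`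
  (`blockOf (x + v) = blockOf x + blockOf v`), `corner_add`, `legSite_add`/`legBond_add`, `legProd_translate`, **`holC_translate`**
  (`u_{τ_vU}(Γ_{y,x}) = u_U(Γ_{y′,x+v})`), `lineU_translate` (the run facts `runSite_add`/`runProd_translate` are the tree's
  `BIJ85SigmaTranslationInvariance`/`BIJ88Eq44CornerCentre` ones, used as local steps, not re-declared); all levels by induction on `k`:
  **`blkIter_add`** (`(x + v)_k = x_k + v_k`), `mem_blockK_add_iff`/`blockK_add_subset_iff` (`B^k(y + v_k) = B^k(y) + v`),
  **`lineIter_translate`** (`(τ_vU)^{(k)} = τ_{v_k}U^{(k)}`), **`holCK_translate`** (`u_{τ_vU}(Γ^{(k)}_{x_k,x}) = u_U(Γ^{(k)}_{(x+v)_k,x+v})`);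
* §4 (the [BalabanImbrieJaffe1988] (2.27) operators of record of `BIJ88NeumannPropagator227Torus`, as `Matrix.submatrix` re-indexings
  by `x ↦ x + v`, `b ↦ b + v`, `y ↦ y + v_k`): `dN_translate`, `qMatK_translate`, **`nOp_translate`** (`H_{k,Ω}(τ_vu) ≅ H_{k,Ω+v}(u)`),
  `proj_translate`, `cproj_translate`, `nPad_translate`, **`gBox_translate`** (`G_k(Ω, τ_vu; x, y) = G_k(Ω + v, u; x + v, y + v)`,
  `gBox_translate_apply`), `gBox_translate_mulVec`, `covD_translate`, `covD_gBox_translate`;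
* §5 the hypotheses of the small-field propagator theorems under translation (plaquettes: the tree's
  `GaugeField.plaqHol_translate` as is): `blkIter_src_eq_tgt_iff`,
  `translate_mem_starB_iff`, and the sup torus distance `T_add_add` (`|x + v − (y + v)|_T = |x − y|_T`);
* §6 `linfty_opNorm_submatrix_equiv` (`‖A ∘ (e × f)‖_{∞→∞} = ‖A‖_{∞→∞}` for bijective re-indexings), `norm_gBox_translate`.

Relation to p-seat file `BIJ88Eq44CornerCentre` (§3 there): it realises a translation of `T^{(j+k)}` by `a` as the fine translation by
`cornerIter k a` (`lineU_translate`/`lineIter_translate`/`cornerIter_add`, no range hypothesis); here the FINE vector `v ∈ L^kℤ^d` is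
primary (`IsCoarse`), as [6]'s windows are given by fine labels, and the block map / blocks / composite transports / Neumann
operators are added; in the standing range the two parametrisations agree (`v = cornerIter k (blkIter k v)`).  That module is not
imported (its cone is foreign to the Neumann-propagator files).  The V1-side (vector-model, [Balaban1984PropagatorsII]) twin of this
transport module is the B6 lane's `Balaban1983to89.B6TranslateV1` (integer vectors `v` with `L^k ∣ v`, `tv P v n`; block maps,
averages, `∂, Δ, Q, R, Δ_a, G`); the objects here (corner contours, `u(Γ^{(k)})`, `χ_ΩD_u`, `Q_k|_Ω`, `H_{k,Ω}(u)`, `G_k(Ω,u)`) are the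
gauge-covariant BIJ ones and are not covered there.

Purpose (p31 gen 26, [Balaban1983RegularityDecay] §2 on the torus): the cube theorems of the tree for `G_k(□, u)` are stated for boxes
`cubeT` placed at a corner `c·L^k` WITHOUT wrap-around; the windows `□_j` of [6]'s partition of unity on a torus always include wrapped
ones — this file moves any `L^k`-aligned window to a no-wrap position, field and all.

Carrier and vocabulary BY NAME (nothing re-declared; one new definition `IsCoarse`; no `def … : Prop` fact): `Balaban1983to89.Site P j`
with its `AddCommGroup` structure and `Site.add_apply`/`Site.shift_add`, `PBond.translate`/`translateEquiv`, `GaugeField.translate`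
(`TorusLimitAxioms`); `blockOf`, `Site.val_blockOf`, `Params.sitesPerDir_eq_mul_succ` (`Setup`/`TorusGeometry`); `inBlock`
(`BIJ88RenormTransf311`); `corner`, `val_corner`, `legSite`, `legBond`, `legProd`, `holC`, `runSite`, `runBond` (`BIJ85BlockAveragesTorus`);
`runProd`, `lineU`, `lineIter`, `blkIter`, `blockK`, `mem_blockK`, `holCK` (`BIJ85BlockAveragesTorusK`); `val_blkIter` (`BIJ85BlockKPoincare`);
`cfg`, `covD`, `starB`, `mem_starB` (`BIJ88Sect3Statements`); `dMat` (`BIJ88Vj5610Operator`); `dN`, `dN_apply`, `qMatK`, `qMatK_apply`,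
`nOp`, `nOp_eq`, `proj`, `cproj`, `nPad`, `gBox` (`BIJ88NeumannPropagator227Torus`); `B5Ineq137Torus.T`, `B4Sect5Torus.tdist`/`ccoord`,
`B4TorusKernel.MultiPeriod.circAbs_add_mul`; Mathlib `Matrix.submatrix_mul`, `inv_submatrix_equiv`, `submatrix_mulVec_equiv`,
`linfty_opNNNorm_def`.

statement-level skeleton of published theorems with citation tags; proofs where landed; nothing here is a claim about the Yang–Mills mass gap

## References
* [BalabanImbrieJaffe1985] T. Bałaban, J. Imbrie, A. Jaffe, Comm. Math. Phys. 97 (1985) 299–329, (2.4)–(2.5) p. 302, (5.1.2)–(5.1.3) p. 313.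
* [BalabanImbrieJaffe1988] T. Bałaban, J. Imbrie, A. Jaffe, Comm. Math. Phys. 114 (1988) 257–315, (1.1) p. 258, (2.27) p. 263.
-/

open scoped BigOperators Matrix ComplexConjugate
open Finset Matrix

namespace Literature.MathematicalPhysics.QuantumFieldTheory.BalabanImbrieJaffe1984to88.BIJ88NeumannPropagatorTranslCovTorus

open Literature.MathematicalPhysics.QuantumFieldTheory.Balaban1983to89
open BIJ88Sect3Statements (U1 toC cfg covD starB mem_starB)
open BIJ88RenormTransf311 (inBlock)
open BIJ85BlockAveragesTorus BIJ85BlockAveragesTorusK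
open BIJ85BlockKPoincare (val_blkIter)
open BIJ88NeumannPropagator227Torus

noncomputable section

variable {P : Params} {j : ℕ}

/-! ## §1 Vectors of the `k`-block lattice -/

/-- `v ∈ T^{(j)}` is a vector of the `k`-BLOCK LATTICE `L^kℤ^d` (every label divisible by `L^k`): the translations `x ↦ x + v` mapping
`k`-blocks onto `k`-blocks ((5.1.2): `B^k(y) = {x : L^kn_μ ≤ x_μ < L^k(n_μ + 1)}`). [cite: BalabanImbrieJaffe1985, (5.1.2) p.313] -/
def IsCoarse (k : ℕ) (v : Balaban1983to89.Site P j) : Prop := ∀ μ : Fin P.d, P.L ^ k ∣ (v μ).val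

/-- Every vector is `0`-coarse. [cite: BalabanImbrieJaffe1985, (5.1.2) p.313] -/
theorem isCoarse_zero_left (v : Balaban1983to89.Site P j) : IsCoarse 0 v := fun μ => by rw [pow_zero]; exact one_dvd _

/-- `k′`-coarse vectors are `k`-coarse for `k ≤ k′`. [cite: BalabanImbrieJaffe1985, (5.1.2) p.313] -/
theorem IsCoarse.mono {k k' : ℕ} (hkk : k ≤ k') {v : Balaban1983to89.Site P j} (hv : IsCoarse k' v) : IsCoarse k v :=
  fun μ => (pow_dvd_pow P.L hkk).trans (hv μ)

/-- `1`-coarse = all labels divisible by `L`. [cite: BalabanImbrieJaffe1985, (2.4) p.302] -/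
theorem IsCoarse.dvd {v : Balaban1983to89.Site P j} (hv : IsCoarse 1 v) (μ : Fin P.d) : P.L ∣ (v μ).val := by
  simpa using hv μ

/-- kernel: labels of a translated site. [folklore] -/
private theorem val_add (x v : Balaban1983to89.Site P j) (μ : Fin P.d) : ((x + v) μ).val = ((x μ).val + (v μ).val) % P.sitesPerDir j := by
  rw [Balaban1983to89.Site.add_apply]
  haveI : NeZero (P.sitesPerDir j) := ⟨by have := P.one_lt_sitesPerDir j; omega⟩
  exact ZMod.val_add _ _

/-- kernel: `L ∣ |T^{(j)}|` in the standing range. [folklore] -/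
private theorem L_dvd_sitesPerDir (hj : j + 1 ≤ P.m + P.K) : P.L ∣ P.sitesPerDir j := by
  rw [P.sitesPerDir_eq_mul_succ hj]; exact dvd_mul_left _ _

/-! ## §2 One level: blocks, corners, the standard contours `Γ_{yx}` and the transports `u(Γ_{yx})` under `x ↦ x + v`, `v ∈ Lℤ^d` -/

section LevelOne

variable (hj : j + 1 ≤ P.m + P.K)
include hj

/-- **In-block offsets are invariant** under translations by `v ∈ Lℤ^d`. [cite: BalabanImbrieJaffe1985, (2.4) p.302] -/
theorem inBlock_add {v : Balaban1983to89.Site P j} (hv : IsCoarse 1 v) (x : Balaban1983to89.Site P j) (κ : Fin P.d) :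
    inBlock (x + v) κ = inBlock x κ := by
  unfold inBlock
  rw [val_add, Nat.mod_mod_of_dvd _ (L_dvd_sitesPerDir hj)]
  obtain ⟨w, hw⟩ := hv.dvd κ
  rw [hw, Nat.add_mul_mod_self_left]

/-- **Blocks go to blocks**: `blockOf (x + v) = blockOf x + blockOf v` for `v ∈ Lℤ^d` (the block map is integer division by `L`
coordinatewise). [cite: BalabanImbrieJaffe1985, (2.4) p.302] -/
theorem blockOf_add {v : Balaban1983to89.Site P j} (hv : IsCoarse 1 v) (x : Balaban1983to89.Site P j) : blockOf (x + v) = blockOf x + blockOf v := by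
  funext μ
  obtain ⟨w, hw⟩ := hv.dvd μ
  have hmod : ∀ s : ℕ, s % P.sitesPerDir j / P.L = s / P.L % P.sitesPerDir (j+1) := fun s => by
    rw [P.sitesPerDir_eq_mul_succ hj, mul_comm, Nat.mod_mul_right_div_self]
  rw [Balaban1983to89.Site.add_apply]
  show ((((x + v) μ).val / P.L : ℕ) : ZMod (P.sitesPerDir (j+1)))
    = (((x μ).val / P.L : ℕ) : ZMod (P.sitesPerDir (j+1))) + (((v μ).val / P.L : ℕ) : ZMod (P.sitesPerDir (j+1)))
  rw [val_add, hmod, hw, Nat.add_mul_div_left _ _ P.L_pos, Nat.mul_div_cancel_left _ P.L_pos, ZMod.natCast_mod, Nat.cast_add]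

/-- **Corners go to corners**: `corner (y + blockOf v) = corner y + v` for `v ∈ Lℤ^d`. [cite: BalabanImbrieJaffe1985, (2.4) p.302] -/
theorem corner_add {v : Balaban1983to89.Site P j} (hv : IsCoarse 1 v) (y : Balaban1983to89.Site P (j+1)) :
    corner (y + blockOf v) = corner y + v := by
  funext κ
  apply ZMod.val_injective
  obtain ⟨w, hw⟩ := hv.dvd κ
  have hvw : (blockOf v κ).val = w := by rw [Balaban1983to89.Site.val_blockOf hj, hw, Nat.mul_div_cancel_left _ P.L_pos]
  haveI : NeZero (P.sitesPerDir (j+1)) := ⟨by have := P.one_lt_sitesPerDir (j+1); omega⟩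
  haveI : NeZero (P.sitesPerDir j) := ⟨by have := P.one_lt_sitesPerDir j; omega⟩
  rw [val_corner hj, Balaban1983to89.Site.add_apply, ZMod.val_add, Balaban1983to89.Site.add_apply, ZMod.val_add, val_corner hj, hvw, hw,
    P.sitesPerDir_eq_mul_succ hj, ← Nat.mul_mod_mul_right, Nat.add_mul, mul_comm P.L w]

/-- **The standard contour is carried along**: `legSite (x + v) μ t = legSite x μ t + v`. [cite: BalabanImbrieJaffe1985, (2.4) p.302] -/
theorem legSite_add {v : Balaban1983to89.Site P j} (hv : IsCoarse 1 v) (x : Balaban1983to89.Site P j) (μ : Fin P.d) (t : ℕ) :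
    legSite (x + v) μ t = legSite x μ t + v := by
  funext κ
  rw [Balaban1983to89.Site.add_apply]
  unfold legSite
  rw [blockOf_add hj hv, corner_add hj hv]
  simp only [Balaban1983to89.Site.add_apply]
  by_cases h1 : κ < μ
  · simp only [if_pos h1]
  · by_cases h2 : κ = μ
    · subst h2; simp only [if_neg h1, if_true]; ring
    · simp only [if_neg h1, if_neg h2]

/-- `legBond (x + v) μ t = legBond x μ t + v`. [cite: BalabanImbrieJaffe1985, (2.4) p.302] -/
theorem legBond_add {v : Balaban1983to89.Site P j} (hv : IsCoarse 1 v) (x : Balaban1983to89.Site P j) (μ : Fin P.d) (t : ℕ) :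
    legBond (x + v) μ t = (legBond x μ t).translate v := by
  unfold legBond
  rw [legSite_add hj hv]; rfl

/-- **`u(Γ)` of the translated field is `u` of the translated contour**, one leg: `legProd (τ_vU) x μ = legProd U (x + v) μ`
(`(τ_vU)(b) = U(b + v)`). [cite: BalabanImbrieJaffe1985, (2.5) p.302] -/
theorem legProd_translate {v : Balaban1983to89.Site P j} (hv : IsCoarse 1 v) (U : GaugeField P j U1) (x : Balaban1983to89.Site P j) (μ : Fin P.d) :
    legProd (U.translate v) x μ = legProd U (x + v) μ := by
  unfold legProd
  rw [inBlock_add hj hv]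
  exact Finset.prod_congr rfl fun t _ => by rw [GaugeField.translate_apply, legBond_add hj hv]

/-- **`u_{τ_vU}(Γ_{y,x}) = u_U(Γ_{y+v/L, x+v})`**: the one-level transport of the translated field. [cite: BalabanImbrieJaffe1985, (2.5) p.302] -/
theorem holC_translate {v : Balaban1983to89.Site P j} (hv : IsCoarse 1 v) (U : GaugeField P j U1) (x : Balaban1983to89.Site P j) :
    holC (U.translate v) x = holC U (x + v) := by
  unfold holC
  exact Finset.prod_congr rfl fun μ _ => legProd_translate hj hv U x μ

end LevelOne

/-- **The `L`-lattice field of the translated field is the translated `L`-lattice field**: `lineU (τ_vU) = τ_{v/L}(lineU U)` for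
`v ∈ Lℤ^d`. [cite: BalabanImbrieJaffe1985, (2.5) p.302] -/
theorem lineU_translate (hj : j + 1 ≤ P.m + P.K) {v : Balaban1983to89.Site P j} (hv : IsCoarse 1 v) (U : GaugeField P j U1) :
    lineU (U.translate v) = (lineU U).translate (blockOf v) := by
  -- straight runs and their ordered products under `x ↦ x + v` (these two facts are the tree's
  -- `BIJ85SigmaTranslationInvariance.runSite_add` / `BIJ88Eq44CornerCentre.runProd_translate`; restated locally, not re-declared,
  -- to keep that module cone out of the Neumann-propagator imports)
  have hrs : ∀ (x : Balaban1983to89.Site P j) (μ : Fin P.d) (t : ℕ), runSite (x + v) μ t = runSite x μ t + v := fun x μ t => by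
    funext κ
    simp only [runSite, Balaban1983to89.Site.add_apply, Function.update_apply]
    split_ifs with h
    · subst h; ring
    · rfl
  have hrp : ∀ (x : Balaban1983to89.Site P j) (μ : Fin P.d) (n : ℕ), runProd (U.translate v) x μ n = runProd U (x + v) μ n := by
    intro x μ n
    induction n with
    | zero => rfl
    | succ n ih =>
      rw [runProd, runProd, ih, GaugeField.translate_apply]
      unfold runBond
      rw [hrs]; rfl
  funext c
  rw [GaugeField.translate_apply]
  unfold lineU
  rw [hrp, PBond.translate_src, PBond.translate_dir, corner_add hj hv]

/-! ## §3 All levels: `x_k`, `B^k(y)`, `u^{(k)}`, `u(Γ^{(k)}_{x_k,x})` under `x ↦ x + v`, `v ∈ L^kℤ^d` -/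

/-- kernel: the block point of a `(k+i)`-coarse vector is `i`-coarse. [cite: BalabanImbrieJaffe1985, (5.1.2) p.313] -/
theorem IsCoarse.blkIter {k i : ℕ} (hk : j + k ≤ P.m + P.K) {v : Balaban1983to89.Site P j} (hv : IsCoarse (k + i) v) :
    IsCoarse i (blkIter k v) := fun μ => by
  rw [val_blkIter k hk]
  exact Nat.dvd_div_of_mul_dvd (by rw [← pow_add]; exact hv μ)

/-- **`(x + v)_k = x_k + v_k`** for `v ∈ L^kℤ^d`. [cite: BalabanImbrieJaffe1985, (5.1.2)–(5.1.3) p.313] -/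
theorem blkIter_add : ∀ (k : ℕ), j + k ≤ P.m + P.K → ∀ {v : Balaban1983to89.Site P j}, IsCoarse k v →
    ∀ x : Balaban1983to89.Site P j, blkIter k (x + v) = blkIter k x + blkIter k v
  | 0, _, _, _, _ => rfl
  | k + 1, hk, v, hv, x => by
    have hk' : j + k ≤ P.m + P.K := by omega
    show blockOf (blkIter k (x + v)) = blockOf (blkIter k x) + blockOf (blkIter k v)
    rw [blkIter_add k hk' (hv.mono (Nat.le_succ k)) x]
    exact blockOf_add (by omega) (hv.blkIter hk') _

/-- **`B^k(y + v_k) = B^k(y) + v`** for `v ∈ L^kℤ^d`. [cite: BalabanImbrieJaffe1985, (5.1.2)–(5.1.3) p.313] -/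
theorem mem_blockK_add_iff {k : ℕ} (hk : j + k ≤ P.m + P.K) {v : Balaban1983to89.Site P j} (hv : IsCoarse k v)
    (y : Balaban1983to89.Site P (j+k)) (x : Balaban1983to89.Site P j) :
    x + v ∈ blockK k (y + blkIter k v) ↔ x ∈ blockK k y := by
  rw [mem_blockK, mem_blockK, blkIter_add k hk hv, add_left_inj]

/-- `B^k(y + v_k) ⊆ Ω + v ↔ B^k(y) ⊆ Ω`. [cite: BalabanImbrieJaffe1985, (5.1.2)–(5.1.3) p.313] -/
theorem blockK_add_subset_iff {k : ℕ} (hk : j + k ≤ P.m + P.K) {v : Balaban1983to89.Site P j} (hv : IsCoarse k v)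
    (y : Balaban1983to89.Site P (j+k)) (Ω : Finset (Balaban1983to89.Site P j)) :
    blockK k (y + blkIter k v) ⊆ Ω.image (· + v) ↔ blockK k y ⊆ Ω := by
  constructor
  · intro h x hx
    have hx' : x + v ∈ Ω.image (· + v) := h ((mem_blockK_add_iff hk hv y x).2 hx)
    obtain ⟨z, hz, hzx⟩ := Finset.mem_image.1 hx'
    rwa [← add_left_injective v hzx]
  · intro h x hx
    have hx' : (x - v) + v ∈ blockK k (y + blkIter k v) := by rwa [sub_add_cancel]
    exact Finset.mem_image.2 ⟨x - v, h ((mem_blockK_add_iff hk hv y (x - v)).1 hx'), sub_add_cancel x v⟩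

/-- **`(τ_vU)^{(k)} = τ_{v_k}(U^{(k)})`** for `v ∈ L^kℤ^d`: the iterated `L`-lattice fields of the translated field.
[cite: BalabanImbrieJaffe1985, (5.1.2)–(5.1.3) p.313] -/
theorem lineIter_translate (U : GaugeField P j U1) : ∀ (k : ℕ), j + k ≤ P.m + P.K → ∀ {v : Balaban1983to89.Site P j}, IsCoarse k v →
    lineIter (U.translate v) k = (lineIter U k).translate (blkIter k v)
  | 0, _, _, _ => rfl
  | k + 1, hk, v, hv => by
    have hk' : j + k ≤ P.m + P.K := by omega
    rw [lineIter_succ, lineIter_succ, lineIter_translate U k hk' (hv.mono (Nat.le_succ k)), lineU_translate (by omega) (hv.blkIter hk')]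
    rfl

/-- **`u_{τ_vU}(Γ^{(k)}_{x_k,x}) = u_U(Γ^{(k)}_{(x+v)_k, x+v})`** for `v ∈ L^kℤ^d`: the composite transports of the translated field are
the transports of the field along the translated composite contours. [cite: BalabanImbrieJaffe1985, (5.1.2)–(5.1.3) p.313] -/
theorem holCK_translate (U : GaugeField P j U1) : ∀ (k : ℕ), j + k ≤ P.m + P.K → ∀ {v : Balaban1983to89.Site P j}, IsCoarse k v →
    ∀ x : Balaban1983to89.Site P j, holCK (U.translate v) k x = holCK U k (x + v)
  | 0, _, _, _, _ => rfl
  | k + 1, hk, v, hv, x => by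
    have hk' : j + k ≤ P.m + P.K := by omega
    have hv' : IsCoarse k v := hv.mono (Nat.le_succ k)
    show holC (lineIter (U.translate v) k) (blkIter k x) * holCK (U.translate v) k x
      = holC (lineIter U k) (blkIter k (x + v)) * holCK U k (x + v)
    rw [holCK_translate U k hk' hv' x, lineIter_translate U k hk' hv', holC_translate (by omega) (hv.blkIter hk'), blkIter_add k hk' hv']

/-! ## §4 The Neumann operators of record under `x ↦ x + v` -/

section Operators

/-- kernel: `x + v ∈ Ω + v ↔ x ∈ Ω`. [folklore] -/
private theorem add_mem_image_iff (Ω : Finset (Balaban1983to89.Site P j)) (x v : Balaban1983to89.Site P j) :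
    x + v ∈ Ω.image (· + v) ↔ x ∈ Ω := by
  constructor
  · intro h
    obtain ⟨z, hz, hzx⟩ := Finset.mem_image.1 h
    rwa [← add_left_injective v hzx]
  · exact fun h => Finset.mem_image.2 ⟨x, h, rfl⟩

/-- **Bonds of `Ω + v` are the translated bonds of `Ω`**: `b + v ⊂ Ω + v ↔ b ⊂ Ω`. [cite: BalabanImbrieJaffe1988, (2.27) p.263] -/
theorem translate_mem_starB_iff (Ω : Finset (Balaban1983to89.Site P j)) (v : Balaban1983to89.Site P j) (b : PBond P j) :
    b.translate v ∈ starB (Ω.image (· + v)) ↔ b ∈ starB Ω := by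
  rw [mem_starB, mem_starB, PBond.translate_src, show (b.translate v).tgt = b.tgt + v from Balaban1983to89.Site.shift_add _ _ _,
    add_mem_image_iff, add_mem_image_iff]

/-- **The Neumann-cut covariant derivative of the translated field**: `χ_ΩD_{τ_vu} = (χ_{Ω+v}D_u)` re-indexed by `b ↦ b + v`,
`x ↦ x + v`. [cite: BalabanImbrieJaffe1988, (2.27) p.263] -/
theorem dN_translate (c : ℝ) (U : GaugeField P j U1) (Ω : Finset (Balaban1983to89.Site P j)) (v : Balaban1983to89.Site P j) :
    dN c (U.translate v) Ω = (dN c U (Ω.image (· + v))).submatrix (PBond.translate v) (· + v) := by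
  ext b x
  rw [submatrix_apply, dN_apply, dN_apply]
  have h1 : b.translate v ∈ starB (Ω.image (· + v)) ↔ b ∈ starB Ω := translate_mem_starB_iff Ω v b
  by_cases hb : b ∈ starB Ω
  · rw [if_pos hb, if_pos (h1.2 hb)]
    unfold BIJ88Vj5610Operator.dMat cfg
    simp only [Matrix.of_apply, GaugeField.translate_apply, show (b.translate v).tgt = b.tgt + v from Balaban1983to89.Site.shift_add _ _ _,
      PBond.translate_src, add_left_inj]
  · rw [if_neg hb, if_neg fun h => hb (h1.1 h)]

/-- **The block average of the translated field**: `Q_k(τ_vu)|_Ω = (Q_k(u)|_{Ω+v})` re-indexed by `y ↦ y + v_k`, `x ↦ x + v`, for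
`v ∈ L^kℤ^d`. [cite: BalabanImbrieJaffe1988, (2.27) p.263] -/
theorem qMatK_translate {k : ℕ} (hk : j + k ≤ P.m + P.K) (U : GaugeField P j U1) (Ω : Finset (Balaban1983to89.Site P j))
    {v : Balaban1983to89.Site P j} (hv : IsCoarse k v) :
    qMatK (U.translate v) k Ω = (qMatK U k (Ω.image (· + v))).submatrix (· + blkIter k v) (· + v) := by
  ext y x
  simp only [submatrix_apply, qMatK_apply, blockK_add_subset_iff hk hv, mem_blockK_add_iff hk hv, holCK_translate U k hk hv]

/-- **THE NEUMANN OPERATOR OF THE TRANSLATED FIELD IS THE TRANSLATED NEUMANN OPERATOR**: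
`H_{k,Ω}(τ_vu) = H_{k,Ω+v}(u)` re-indexed by `x ↦ x + v`, for `v ∈ L^kℤ^d` (the torus is homogeneous under the translations of the
`k`-block lattice). [cite: BalabanImbrieJaffe1988, (2.27) p.263] -/
theorem nOp_translate {k : ℕ} (hk : j + k ≤ P.m + P.K) (a c : ℝ) (U : GaugeField P j U1) (Ω : Finset (Balaban1983to89.Site P j))
    {v : Balaban1983to89.Site P j} (hv : IsCoarse k v) :
    nOp a c (U.translate v) k Ω = (nOp a c U k (Ω.image (· + v))).submatrix (· + v) (· + v) := by
  rw [nOp_eq, nOp_eq, dN_translate, qMatK_translate hk U Ω hv, conjTranspose_submatrix, conjTranspose_submatrix]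
  simp only [submatrix_add, submatrix_smul, Pi.add_apply, Pi.smul_apply]
  rw [submatrix_mul _ _ (· + v) (PBond.translate v) (· + v) (PBond.translateEquiv v).bijective,
    submatrix_mul _ _ (· + v) (· + blkIter k v) (· + v) (Equiv.addRight (blkIter k v)).bijective]

/-- `1_Ω` re-indexed: `proj Ω = (proj (Ω + v))` re-indexed by `x ↦ x + v`. [cite: BalabanImbrieJaffe1988, (2.27) p.263] -/
theorem proj_translate (Ω : Finset (Balaban1983to89.Site P j)) (v : Balaban1983to89.Site P j) :
    proj Ω = (proj (Ω.image (· + v))).submatrix (· + v) (· + v) := by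
  ext x y
  rw [submatrix_apply]
  unfold proj
  simp only [diagonal_apply, add_mem_image_iff, add_left_inj]

/-- `1_{Ωᶜ}` re-indexed. [cite: BalabanImbrieJaffe1988, (2.27) p.263] -/
theorem cproj_translate (Ω : Finset (Balaban1983to89.Site P j)) (v : Balaban1983to89.Site P j) :
    cproj Ω = (cproj (Ω.image (· + v))).submatrix (· + v) (· + v) := by
  ext x y
  rw [submatrix_apply]
  unfold cproj
  simp only [diagonal_apply, add_mem_image_iff, add_left_inj]

/-- The padded operator re-indexed. [cite: BalabanImbrieJaffe1988, (2.27) p.263] -/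
theorem nPad_translate {k : ℕ} (hk : j + k ≤ P.m + P.K) (a c : ℝ) (U : GaugeField P j U1) (Ω : Finset (Balaban1983to89.Site P j))
    {v : Balaban1983to89.Site P j} (hv : IsCoarse k v) :
    nPad a c (U.translate v) k Ω = (nPad a c U k (Ω.image (· + v))).submatrix (· + v) (· + v) := by
  unfold nPad
  rw [nOp_translate hk a c U Ω hv, cproj_translate Ω v, submatrix_add]
  rfl

/-- **THE NEUMANN PROPAGATOR OF THE TRANSLATED FIELD IS THE TRANSLATED NEUMANN PROPAGATOR**:
`G_k(Ω, τ_vu) = G_k(Ω + v, u)` re-indexed by `x ↦ x + v`, i.e. `G_k(Ω, τ_vu; x, y) = G_k(Ω + v, u; x + v, y + v)`, for every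
`v ∈ L^kℤ^d`, every `U(1)` field, every `Ω`. [cite: BalabanImbrieJaffe1988, (2.27) p.263] -/
theorem gBox_translate {k : ℕ} (hk : j + k ≤ P.m + P.K) (a c : ℝ) (U : GaugeField P j U1) (Ω : Finset (Balaban1983to89.Site P j))
    {v : Balaban1983to89.Site P j} (hv : IsCoarse k v) :
    gBox a c (U.translate v) k Ω = (gBox a c U k (Ω.image (· + v))).submatrix (· + v) (· + v) := by
  unfold gBox
  rw [nPad_translate hk a c U Ω hv, proj_translate Ω v,
    show (nPad a c U k (Ω.image (· + v))).submatrix (· + v) (· + v)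
      = (nPad a c U k (Ω.image (· + v))).submatrix (Equiv.addRight v) (Equiv.addRight v) from rfl,
    inv_submatrix_equiv,
    show (proj (Ω.image (· + v))).submatrix (fun x : Balaban1983to89.Site P j => x + v) (· + v)
      = (proj (Ω.image (· + v))).submatrix (Equiv.addRight v) (Equiv.addRight v) from rfl,
    submatrix_mul_equiv]
  rfl

/-- kernel, entrywise: `G_k(Ω, τ_vu; x, y) = G_k(Ω + v, u; x + v, y + v)`. [cite: BalabanImbrieJaffe1988, (2.27) p.263] -/
theorem gBox_translate_apply {k : ℕ} (hk : j + k ≤ P.m + P.K) (a c : ℝ) (U : GaugeField P j U1) (Ω : Finset (Balaban1983to89.Site P j))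
    {v : Balaban1983to89.Site P j} (hv : IsCoarse k v) (x y : Balaban1983to89.Site P j) :
    gBox a c (U.translate v) k Ω x y = gBox a c U k (Ω.image (· + v)) (x + v) (y + v) := by
  rw [gBox_translate hk a c U Ω hv, submatrix_apply]

/-- **`(G_k(Ω, τ_vu)f)(x) = (G_k(Ω + v, u)(τ_{-v}f))(x + v)`** with `(τ_{-v}f)(z) = f(z − v)`. [cite: BalabanImbrieJaffe1988, (2.27) p.263] -/
theorem gBox_translate_mulVec {k : ℕ} (hk : j + k ≤ P.m + P.K) (a c : ℝ) (U : GaugeField P j U1) (Ω : Finset (Balaban1983to89.Site P j))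
    {v : Balaban1983to89.Site P j} (hv : IsCoarse k v) (f : Balaban1983to89.Site P j → ℂ) (x : Balaban1983to89.Site P j) :
    (gBox a c (U.translate v) k Ω *ᵥ f) x = (gBox a c U k (Ω.image (· + v)) *ᵥ fun z => f (z - v)) (x + v) := by
  rw [gBox_translate hk a c U Ω hv,
    show (gBox a c U k (Ω.image (· + v))).submatrix (fun x : Balaban1983to89.Site P j => x + v) (· + v)
      = (gBox a c U k (Ω.image (· + v))).submatrix (fun x : Balaban1983to89.Site P j => x + v) (Equiv.addRight v) from rfl,
    submatrix_mulVec_equiv]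
  have hf : (f ∘ ⇑(Equiv.addRight v).symm) = fun z => f (z - v) := funext fun z => by simp [sub_eq_add_neg]
  rw [hf]
  rfl

/-- **The covariant derivative of the translated field**: `(D_{τ_vu}φ)(b) = (D_u(τ_{-v}φ))(b + v)`. [cite: BalabanImbrieJaffe1988, (1.1) p.258] -/
theorem covD_translate (c : ℝ) (U : GaugeField P j U1) (v : Balaban1983to89.Site P j) (φ : Balaban1983to89.Site P j → ℂ) (b : PBond P j) :
    covD c (cfg (U.translate v)) φ b = covD c (cfg U) (fun z => φ (z - v)) (b.translate v) := by
  unfold covD cfg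
  simp only [GaugeField.translate_apply, show (b.translate v).tgt = b.tgt + v from Balaban1983to89.Site.shift_add _ _ _,
    PBond.translate_src, add_sub_cancel_right]

/-- **`(D_{τ_vu}G_k(Ω, τ_vu)f)(b) = (D_uG_k(Ω + v, u)(τ_{-v}f))(b + v)`** — the derivative member transported.
[cite: BalabanImbrieJaffe1988, (2.27) p.263] -/
theorem covD_gBox_translate {k : ℕ} (hk : j + k ≤ P.m + P.K) (a c c' : ℝ) (U : GaugeField P j U1) (Ω : Finset (Balaban1983to89.Site P j))
    {v : Balaban1983to89.Site P j} (hv : IsCoarse k v) (f : Balaban1983to89.Site P j → ℂ) (b : PBond P j) :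
    covD c' (cfg (U.translate v)) (gBox a c (U.translate v) k Ω *ᵥ f) b
      = covD c' (cfg U) (gBox a c U k (Ω.image (· + v)) *ᵥ fun z => f (z - v)) (b.translate v) := by
  have hφ : (fun z => (gBox a c (U.translate v) k Ω *ᵥ f) (z - v)) = gBox a c U k (Ω.image (· + v)) *ᵥ fun z => f (z - v) :=
    funext fun z => by rw [gBox_translate_mulVec hk a c U Ω hv, sub_add_cancel]
  rw [covD_translate, hφ]

end Operators

/-! ## §5 The field hypotheses and the torus distance under `x ↦ x + v` -/

section Hypotheses

/-- Block points of bond ends: `(b + v)_{±,k} agree ↔ b_{±,k} agree` for `v ∈ L^kℤ^d` (the «bond inside one `k`-block» condition is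
translation invariant). [cite: BalabanImbrieJaffe1985, (5.1.2) p.313] -/
theorem blkIter_src_eq_tgt_iff {k : ℕ} (hk : j + k ≤ P.m + P.K) {v : Balaban1983to89.Site P j} (hv : IsCoarse k v) (b : PBond P j) :
    blkIter k (b.translate v).src = blkIter k (b.translate v).tgt ↔ blkIter k b.src = blkIter k b.tgt := by
  rw [PBond.translate_src, show (b.translate v).tgt = b.tgt + v from Balaban1983to89.Site.shift_add _ _ _, blkIter_add k hk hv,
    blkIter_add k hk hv, add_left_inj]

/-- kernel: the circular distance only sees labels modulo the period. [folklore] -/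
private theorem circAbs_mod_sub_mod (N p q : ℕ) :
    B4TorusKernel.MultiPeriod.circAbs N (((p % N : ℕ) : ℤ) - ((q % N : ℕ) : ℤ)) = B4TorusKernel.MultiPeriod.circAbs N ((p : ℤ) - q) := by
  rw [Int.natCast_mod, Int.natCast_mod, Int.emod_def, Int.emod_def,
    show (p : ℤ) - N * (p / N) - ((q : ℤ) - N * (q / N)) = ((p : ℤ) - q) + N * ((q : ℤ) / N - (p : ℤ) / N) by ring,
    B4TorusKernel.MultiPeriod.circAbs_add_mul]

/-- **The sup torus distance is translation invariant**: `|x + v − (y + v)|_T = |x − y|_T` (the distance of the decay statements (2.30)).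
[cite: BalabanImbrieJaffe1988, (2.30) p.263] -/
theorem T_add_add (x y v : Balaban1983to89.Site P j) : B5Ineq137Torus.T P j (x + v) (y + v) = B5Ineq137Torus.T P j x y := by
  unfold B5Ineq137Torus.T B4Sect5Torus.tdist
  congr 2
  funext i
  unfold B4Sect5Torus.ccoord B5Ineq137Torus.toT
  simp only [val_add]
  rw [show B5Ineq137Torus.Nv P j i = P.sitesPerDir j from rfl, circAbs_mod_sub_mod]
  congr 2
  push_cast
  ring

end Hypotheses

/-! ## §6 Re-indexing does not change the `ℓ^∞ → ℓ^∞` operator norm -/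

section Norms

open scoped Matrix.Norms.Operator

/-- **`‖A ∘ (e × f)‖_{∞→∞} = ‖A‖_{∞→∞}`** for bijective re-indexings of rows and columns (the max row sum is a max over the same
row sums) — the «reasonable norm» of (2.12) is blind to relabelling the torus. [cite: Balaban1983RegularityDecay, (2.12) p.577] -/
theorem linfty_opNorm_submatrix_equiv {l m n o : Type*} [Fintype l] [Fintype m] [Fintype n] [Fintype o]
    (A : Matrix m n ℂ) (e : l ≃ m) (f : o ≃ n) : ‖A.submatrix e f‖ = ‖A‖ := by
  have h : ‖A.submatrix e f‖₊ = ‖A‖₊ := by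
    rw [linfty_opNNNorm_def, linfty_opNNNorm_def]
    apply le_antisymm
    · refine Finset.sup_le fun i _ => ?_
      have e1 : ∑ j, ‖A.submatrix e f i j‖₊ = ∑ j, ‖A (e i) j‖₊ := Equiv.sum_comp f (fun j => ‖A (e i) j‖₊)
      rw [e1]
      exact Finset.le_sup (f := fun i' => ∑ j, ‖A i' j‖₊) (Finset.mem_univ (e i))
    · refine Finset.sup_le fun i' _ => ?_
      have e1 : ∑ j, ‖A.submatrix e f (e.symm i') j‖₊ = ∑ j, ‖A i' j‖₊ := by
        rw [show (fun j => ‖A.submatrix e f (e.symm i') j‖₊) = fun j => ‖A i' (f j)‖₊ from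
          funext fun j => by rw [submatrix_apply, Equiv.apply_symm_apply]]
        exact Equiv.sum_comp f (fun j => ‖A i' j‖₊)
      rw [← e1]
      exact Finset.le_sup (f := fun i => ∑ j, ‖A.submatrix e f i j‖₊) (Finset.mem_univ (e.symm i'))
  rw [← coe_nnnorm, ← coe_nnnorm, h]

/-- **`‖G_k(Ω, τ_vu)‖_{∞→∞} = ‖G_k(Ω + v, u)‖_{∞→∞}`** for `v ∈ L^kℤ^d`. [cite: BalabanImbrieJaffe1988, (2.27) p.263] -/
theorem norm_gBox_translate {k : ℕ} (hk : j + k ≤ P.m + P.K) (a c : ℝ) (U : GaugeField P j U1) (Ω : Finset (Balaban1983to89.Site P j))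
    {v : Balaban1983to89.Site P j} (hv : IsCoarse k v) :
    ‖gBox a c (U.translate v) k Ω‖ = ‖gBox a c U k (Ω.image (· + v))‖ := by
  rw [gBox_translate hk a c U Ω hv]
  exact linfty_opNorm_submatrix_equiv _ (Equiv.addRight v) (Equiv.addRight v)

/-- Any matrix conjugated by the translation: `‖A ∘ (τ_v × τ_v)‖ = ‖A‖`. [cite: Balaban1983RegularityDecay, (2.12) p.577] -/
theorem norm_submatrix_add (A : Matrix (Balaban1983to89.Site P j) (Balaban1983to89.Site P j) ℂ) (v : Balaban1983to89.Site P j) :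
    ‖A.submatrix (· + v) (· + v)‖ = ‖A‖ :=
  linfty_opNorm_submatrix_equiv A (Equiv.addRight v) (Equiv.addRight v)

end Norms

end

end Literature.MathematicalPhysics.QuantumFieldTheory.BalabanImbrieJaffe1984to88.BIJ88NeumannPropagatorTranslCovTorus
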